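import Summits.QuantumFields.YangMills.Theorems.FemtoTransferGapSlab
import Summits.QuantumFields.YangMills.Theorems.LuscherReductionOneSiteLevelsVariational
import Summits.QuantumFields.YangMills.Theorems.LuscherReductionOneSiteLevelsIMS
import Literature.MathematicalPhysics.QuantumFieldTheory.ConstructiveQFTWave0Proofs
import Literature.MathematicalPhysics.QuantumLattice.SU2Haar
import HarnessLib

/-!
# Slab currency, fixed-lattice support I: symmetries of the transfer kernel, the transfer operator on physical test
# functions, and the vacuum proxies `Φ_m = K_β^m 1` (physical, uniformly positive, `‖Φ_m‖² > 0`)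

Support module for route `LuscherReduction` (QuantumFields ∕ YangMills; rung leaf R2b1 `FemtoGapOfRecord`), crux
`RunningReduction` (stmt-QuantumFields-19978), owner input №3 «slab currency» (planner ym-beyond-p1 g15; defs module
`Theorems/FemtoTransferGapSlab.lean`; targets = the fixed-lattice support layer of `Sketch-RED-slab.lean`).  Fleet service by
seat ym-infvol-p2 (cell ym-fleet).  Everything here is elementary measure theory at FIXED lattice `(ℤ/L)³`, every `L ≥ 1`,
every real `β`:

* §1 symmetries of the kernel for ANY group and matrix representation: `timeCoupling_gaugeTransform`,
  `transferKernel_gaugeTransform` (simultaneous gauge transformation of both slices), `plaquetteHolonomy_twist_of_mem_center`,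
  `wilsonAction_twist_of_mem_center`, `timeCoupling_twist`, `transferKernel_twist` (simultaneous centre twist; each spatial
  plaquette carries zero or two twisted links with opposite orientation, central factors cancel);
* §2 the a-priori measure is invariant under gauge transformations (tree `WilsonGauge.measurePreserving_gaugeTransform`) and
  centre twists (`measurePreserving_twist`); change of variables `integral_comp_eq_of_measurePreserving`;
* §3 the transfer operator `transferApply β` (`SU(2)`): integrability of `K_β(U,·)φ`, the bound `|K_β φ| ≤ (sup K)·C`, order
  preservation, and **`isPhys_transferApply`**: `K_β` maps physical zero-flux test functions to physical ones;
* §4 the vacuum proxies: **`isPhys_slabGround`**, `exists_pos_le_slabGround` (`Φ_m ≥ (inf K)^m > 0` pointwise),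
  **`l2_slabGround_pos`** (`‖Φ_m‖² > 0`, every real `β` — the Sketch asks it for `β ≥ 0`).

HONEST FRAMING: femto-universe infrastructure at fixed lattice; no renormalisation-group content; nothing here bears on
infinite volume or the Clay gap.  References: E. Seiler, LNP 159 (1982) §3; M. Lüscher, NPB 219 (1983); G. 't Hooft, NPB 153 (1979).
-/

set_option autoImplicit false

noncomputable section

open MeasureTheory Filter Topology Real
open Literature.MathematicalPhysics.QuantumFieldTheory
open Literature.MathematicalPhysics.QuantumLattice
open Literature.Analysis.OperatorTheory.YMMatrixModel

namespace Summit.QuantumFields.YangMills.Theorems.FemtoTransferGap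

/-! ### §1. Gauge and twist symmetries of the transfer kernel (any group, any matrix representation) -/

section KernelSymmetry

variable {N : ℕ} {G : Type*} [Group G] (ρ : G →* Matrix (Fin N) (Fin N) ℂ)

/-- The time-like coupling is invariant under a simultaneous gauge transformation of both slices (each summand is the trace of
a conjugate). [cite: SeilerLNP1982, §3] -/
theorem timeCoupling_gaugeTransform {L : ℕ} [NeZero L] (g : Site 3 L → G) (U V : GaugeConfig 3 L G) :
    timeCoupling ρ (gaugeTransform g U) (gaugeTransform g V) = timeCoupling ρ U V := by
  unfold timeCoupling
  refine Finset.sum_congr rfl fun e _ => ?_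
  have h : gaugeTransform g U e * (gaugeTransform g V e)⁻¹ = g e.1 * (U e * (V e)⁻¹) * (g e.1)⁻¹ := by
    simp only [gaugeTransform, mul_inv_rev, inv_inv]
    group
  rw [h, map_mul, map_mul, Matrix.trace_mul_cycle, ← map_mul, inv_mul_cancel, map_one, one_mul]

/-- **The transfer kernel is gauge invariant**: `K_β(U^g, V^g) = K_β(U, V)`. [cite: SeilerLNP1982, §3] -/
theorem transferKernel_gaugeTransform {L : ℕ} [NeZero L] (β : ℝ) (g : Site 3 L → G) (U V : GaugeConfig 3 L G) :
    transferKernel ρ β (gaugeTransform g U) (gaugeTransform g V) = transferKernel ρ β U V := by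
  unfold transferKernel
  rw [timeCoupling_gaugeTransform, wilsonAction_gaugeTransform, wilsonAction_gaugeTransform]

omit ρ in
/-- The centre twist multiplies each link by a central factor: `z` on the twisted links, `1` elsewhere. [folklore] -/
theorem twist_apply_eq_ite_mul {L : ℕ} (k : Fin 3) (z : G) (U : GaugeConfig 3 L G) (e : Edge 3 L) :
    twist k z U e = (if e.2 = k ∧ e.1 k = 0 then z else 1) * U e := by
  unfold twist
  split_ifs <;> simp

omit ρ in
/-- `(z a) b (z c)⁻¹ d⁻¹ = a b c⁻¹ d⁻¹` for central `z`. [folklore] -/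
theorem center_mul_mul_mul_inv_mul_inv {z : G} (hz : z ∈ Subgroup.center G) (a b c d : G) :
    z * a * b * (z * c)⁻¹ * d⁻¹ = a * b * c⁻¹ * d⁻¹ := by
  have hc : ∀ g : G, g * z = z * g := fun g => Subgroup.mem_center_iff.1 hz g
  rw [mul_inv_rev]
  calc z * a * b * (c⁻¹ * z⁻¹) * d⁻¹ = z * (a * b * c⁻¹) * z⁻¹ * d⁻¹ := by simp only [mul_assoc]
    _ = a * b * c⁻¹ * z * z⁻¹ * d⁻¹ := by rw [← hc (a * b * c⁻¹)]
    _ = a * b * c⁻¹ * d⁻¹ := by rw [mul_inv_cancel_right]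

omit ρ in
/-- `a (z b) c⁻¹ (z d)⁻¹ = a b c⁻¹ d⁻¹` for central `z`. [folklore] -/
theorem mul_center_mul_mul_inv_mul_inv {z : G} (hz : z ∈ Subgroup.center G) (a b c d : G) :
    a * (z * b) * c⁻¹ * (z * d)⁻¹ = a * b * c⁻¹ * d⁻¹ := by
  have hc : ∀ g : G, g * z = z * g := fun g => Subgroup.mem_center_iff.1 hz g
  rw [mul_inv_rev]
  calc a * (z * b) * c⁻¹ * (d⁻¹ * z⁻¹) = a * (z * (b * c⁻¹ * d⁻¹)) * z⁻¹ := by simp only [mul_assoc]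
    _ = a * (b * c⁻¹ * d⁻¹) * z * z⁻¹ := by rw [← hc (b * c⁻¹ * d⁻¹)]; simp only [mul_assoc]
    _ = a * b * c⁻¹ * d⁻¹ := by rw [mul_inv_cancel_right]; simp only [mul_assoc]

omit ρ in
/-- **Plaquette holonomies are twist invariant** (central `z`, genuine plaquette `i ≠ j`): a spatial plaquette contains zero or two
twisted links, with opposite orientation, and the central factors cancel. [cite: tHooft1979] -/
theorem plaquetteHolonomy_twist_of_mem_center {L : ℕ} (k : Fin 3) {z : G} (hz : z ∈ Subgroup.center G)
    (U : GaugeConfig 3 L G) (x : Site 3 L) {i j : Fin 3} (hij : i ≠ j) :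
    plaquetteHolonomy (twist k z U) x i j = plaquetteHolonomy U x i j := by
  have hsh : ∀ (y : Site 3 L) {a b : Fin 3}, b ≠ a → (y.shift a) b = y b := fun y a b hab => by
    simp [Site.shift, Pi.single_eq_of_ne hab]
  unfold plaquetteHolonomy
  simp only [twist]
  by_cases hki : i = k
  · subst hki
    simp only [Ne.symm hij, false_and, if_false, true_and, hsh x hij]
    by_cases hx : x i = 0
    · simp only [hx, if_true]
      exact center_mul_mul_mul_inv_mul_inv hz _ _ _ _
    · simp only [hx, if_false]
  · by_cases hkj : j = k
    · subst hkj
      simp only [hki, false_and, if_false, true_and, hsh x hij.symm]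
      by_cases hx : x j = 0
      · simp only [hx, if_true]
        exact mul_center_mul_mul_inv_mul_inv hz _ _ _ _
      · simp only [hx, if_false]
    · simp only [hki, hkj, false_and, if_false]

/-- **The Wilson action of the three-torus is twist invariant** for a central twist (every `L`; the one-site case is the tree's
`wilsonAction_twist`). [cite: tHooft1979] -/
theorem wilsonAction_twist_of_mem_center {L : ℕ} [NeZero L] (k : Fin 3) {z : G} (hz : z ∈ Subgroup.center G)
    (U : GaugeConfig 3 L G) : wilsonAction ρ (twist k z U) = wilsonAction ρ U := by
  unfold wilsonAction
  refine Finset.sum_congr rfl fun p _ => ?_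
  rw [plaquetteHolonomy_twist_of_mem_center k hz U p.1 (ne_of_lt p.2.2)]

/-- The time-like coupling is invariant under a simultaneous central twist of both slices. [cite: tHooft1979] -/
theorem timeCoupling_twist {L : ℕ} [NeZero L] (k : Fin 3) {z : G} (hz : z ∈ Subgroup.center G) (U V : GaugeConfig 3 L G) :
    timeCoupling ρ (twist k z U) (twist k z V) = timeCoupling ρ U V := by
  have hc : ∀ g : G, g * z = z * g := fun g => Subgroup.mem_center_iff.1 hz g
  unfold timeCoupling
  refine Finset.sum_congr rfl fun e _ => ?_
  have h : twist k z U e * (twist k z V e)⁻¹ = U e * (V e)⁻¹ := by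
    simp only [twist]
    split_ifs
    · rw [mul_inv_rev, show z * U e * ((V e)⁻¹ * z⁻¹) = z * (U e * (V e)⁻¹) * z⁻¹ by simp only [mul_assoc],
        ← hc, mul_inv_cancel_right]
    · rfl
  rw [h]

/-- **The transfer kernel is twist invariant**: `K_β(twist U, twist V) = K_β(U, V)` for a central twist. [cite: tHooft1979] -/
theorem transferKernel_twist {L : ℕ} [NeZero L] (β : ℝ) (k : Fin 3) {z : G} (hz : z ∈ Subgroup.center G)
    (U V : GaugeConfig 3 L G) : transferKernel ρ β (twist k z U) (twist k z V) = transferKernel ρ β U V := by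
  unfold transferKernel
  rw [timeCoupling_twist ρ k hz, wilsonAction_twist_of_mem_center ρ k hz, wilsonAction_twist_of_mem_center ρ k hz]

end KernelSymmetry

/-! ### §2. Invariance of the a-priori measure; change of variables -/

section Measure

variable {G : Type*} [Group G] [TopologicalSpace G] [IsTopologicalGroup G] [CompactSpace G]
  [MeasurableSpace G] [BorelSpace G]

/-- Gauge transformations preserve the a-priori measure `configMeasure` (tree `WilsonGauge.measurePreserving_gaugeTransform`). [folklore] -/
theorem measurePreserving_gaugeTransform_configMeasure {L : ℕ} [NeZero L] (g : Site 3 L → G) :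
    MeasurePreserving (gaugeTransform g : GaugeConfig 3 L G → GaugeConfig 3 L G) (configMeasure G L) (configMeasure G L) :=
  WilsonGauge.measurePreserving_gaugeTransform g

/-- Centre twists preserve the a-priori measure (link by link a left translation or the identity). [folklore] -/
theorem measurePreserving_twist {L : ℕ} [NeZero L] (k : Fin 3) (z : G) :
    MeasurePreserving (twist k z : GaugeConfig 3 L G → GaugeConfig 3 L G) (configMeasure G L) (configMeasure G L) := by
  refine measurePreserving_pi (f := fun (e : Edge 3 L) (x : G) => if e.2 = k ∧ e.1 k = 0 then z * x else x)
    (fun _ : Edge 3 L => haarProbability G) (fun _ : Edge 3 L => haarProbability G) fun e => ?_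
  by_cases h : e.2 = k ∧ e.1 k = 0
  · simp only [h, and_self, if_true]
    exact measurePreserving_mul_left (haarProbability G) z
  · simp only [h, if_false]
    exact MeasurePreserving.id _

/-- Change of variables along a measure-preserving map, for a measurable real integrand. [folklore] -/
theorem integral_comp_eq_of_measurePreserving {L : ℕ} [NeZero L] {T : GaugeConfig 3 L G → GaugeConfig 3 L G}
    (hT : MeasurePreserving T (configMeasure G L) (configMeasure G L)) {F : GaugeConfig 3 L G → ℝ} (hF : Measurable F) :
    ∫ U, F (T U) ∂configMeasure G L = ∫ U, F U ∂configMeasure G L := by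
  have h := integral_map (μ := configMeasure G L) hT.measurable.aemeasurable (f := F) hF.aestronglyMeasurable
  rw [hT.map_eq] at h
  exact h.symm

end Measure

/-! ### §3. The transfer operator on bounded measurable and on physical test functions (`SU(2)`) -/

section Transfer

variable {L : ℕ} [NeZero L]

/-- `transferApply` unfolded. [folklore] -/
theorem transferApply_apply (β : ℝ) (φ : GaugeConfig 3 L SU2 → ℝ) (U : GaugeConfig 3 L SU2) :
    transferApply β φ U = ∫ V, transferKernel su2Rep β U V * φ V ∂(configMeasure SU2 L) := rfl

/-- The section `V ↦ K_β(U,V)` of the transfer kernel is continuous. [folklore] -/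
theorem continuous_transferKernel_right (β : ℝ) (U : GaugeConfig 3 L SU2) :
    Continuous fun V : GaugeConfig 3 L SU2 => transferKernel su2Rep β U V := by
  have hg : Continuous fun V : GaugeConfig 3 L SU2 => (U, V) := Continuous.prodMk_right U
  have hK : Continuous fun p : GaugeConfig 3 L SU2 × GaugeConfig 3 L SU2 => transferKernel su2Rep β p.1 p.2 :=
    continuous_transferKernel su2Rep continuous_su2Rep β
  have h := hK.comp hg
  simpa only [Function.comp_def] using h

/-- `K_β(U,·) φ` is integrable for bounded measurable `φ`. [folklore] -/
theorem integrable_transferKernel_mul (β : ℝ) (U : GaugeConfig 3 L SU2) {φ : GaugeConfig 3 L SU2 → ℝ}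
    (hφm : Measurable φ) {C : ℝ} (hφb : ∀ V, |φ V| ≤ C) :
    Integrable (fun V => transferKernel su2Rep β U V * φ V) (configMeasure SU2 L) := by
  haveI : SecondCountableTopology SU2 := secondCountableTopology_su2
  obtain ⟨M, hM⟩ := exists_transferKernel_le su2Rep continuous_su2Rep β (L := L)
  refine Integrable.mono' (integrable_const (M * C))
    ((continuous_transferKernel_right β U).measurable.mul hφm).aestronglyMeasurable (ae_of_all _ fun V => ?_)
  have hK := transferKernel_pos su2Rep β U V
  rw [Real.norm_eq_abs, abs_mul, abs_of_pos hK]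
  exact mul_le_mul (hM U V) (hφb V) (abs_nonneg _) (hK.le.trans (hM U V))

/-- **Order preservation**: `φ ≤ ψ` pointwise (both bounded measurable) gives `K_β φ ≤ K_β ψ` pointwise. [folklore] -/
theorem transferApply_mono (β : ℝ) {φ ψ : GaugeConfig 3 L SU2 → ℝ} (hφm : Measurable φ) {C : ℝ} (hφb : ∀ V, |φ V| ≤ C)
    (hψm : Measurable ψ) {D : ℝ} (hψb : ∀ V, |ψ V| ≤ D) (hle : ∀ V, φ V ≤ ψ V) (U : GaugeConfig 3 L SU2) :
    transferApply β φ U ≤ transferApply β ψ U :=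
  integral_mono (integrable_transferKernel_mul β U hφm hφb) (integrable_transferKernel_mul β U hψm hψb) fun V =>
    mul_le_mul_of_nonneg_left (hle V) (transferKernel_pos su2Rep β U V).le

/-- `K_β` applied to a constant: `(K_β c)(U) = c · ∫ K_β(U,V) dV ≥ c · inf K` for `c ≥ 0`. [folklore] -/
theorem const_mul_le_transferApply_const (β : ℝ) {m : ℝ} (hm : ∀ U V : GaugeConfig 3 L SU2, m ≤ transferKernel su2Rep β U V)
    {c : ℝ} (hc : 0 ≤ c) (U : GaugeConfig 3 L SU2) : m * c ≤ transferApply β (fun _ => c) U := by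
  have h := integral_mono (integrable_const (m * c))
    (integrable_transferKernel_mul β U measurable_const (C := |c|) fun _ => le_rfl) fun V =>
      mul_le_mul_of_nonneg_right (hm U V) hc
  simpa [transferApply] using h

/-- **`|K_β φ| ≤ (sup K_β) · C`** for `|φ| ≤ C` measurable. [folklore] -/
theorem abs_transferApply_le (β : ℝ) {M : ℝ} (hM : ∀ U V : GaugeConfig 3 L SU2, transferKernel su2Rep β U V ≤ M)
    {φ : GaugeConfig 3 L SU2 → ℝ} (hφm : Measurable φ) {C : ℝ} (hφb : ∀ V, |φ V| ≤ C) (U : GaugeConfig 3 L SU2) :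
    |transferApply β φ U| ≤ M * C := by
  rw [transferApply_apply]
  calc |∫ V, transferKernel su2Rep β U V * φ V ∂configMeasure SU2 L|
      ≤ ∫ V, |transferKernel su2Rep β U V * φ V| ∂configMeasure SU2 L := abs_integral_le_integral_abs
    _ ≤ ∫ _V, M * C ∂configMeasure SU2 L := by
        refine integral_mono (integrable_transferKernel_mul β U hφm hφb).abs (integrable_const _) fun V => ?_
        have hK := transferKernel_pos su2Rep β U V
        rw [abs_mul, abs_of_pos hK]
        exact mul_le_mul (hM U V) (hφb V) (abs_nonneg _) (hK.le.trans (hM U V))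
    _ = M * C := by simp

/-- **`K_β φ` is measurable** for bounded measurable `φ` (the integrand is jointly measurable; Fubini measurability). [folklore] -/
theorem measurable_transferApply (β : ℝ) {φ : GaugeConfig 3 L SU2 → ℝ} (hφm : Measurable φ) :
    Measurable (transferApply (L := L) β φ) := by
  haveI : SecondCountableTopology SU2 := secondCountableTopology_su2
  have hF : StronglyMeasurable fun p : GaugeConfig 3 L SU2 × GaugeConfig 3 L SU2 =>
      transferKernel su2Rep β p.1 p.2 * φ p.2 :=
    ((continuous_transferKernel su2Rep continuous_su2Rep β).measurable.mul (hφm.comp measurable_snd)).stronglyMeasurable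
  exact (hF.integral_prod_right' (ν := configMeasure SU2 L)).measurable

/-- **The transfer operator preserves physical zero-flux test functions**: `K_β φ` is measurable and bounded, gauge invariant
(`K_β(U^g, V) = K_β(U, V^{g⁻¹})`-type change of variables with the gauge-invariant a-priori measure) and twist invariant
(same with the centre twist). [cite: Luscher1983] -/
theorem isPhys_transferApply (β : ℝ) {φ : GaugeConfig 3 L SU2 → ℝ} (hφ : IsPhys φ) : IsPhys (transferApply (L := L) β φ) := by
  haveI : SecondCountableTopology SU2 := secondCountableTopology_su2
  obtain ⟨C, hC⟩ := hφ.bounded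
  obtain ⟨M, hM⟩ := exists_transferKernel_le su2Rep continuous_su2Rep β (L := L)
  refine ⟨measurable_transferApply β hφ.measurable, ⟨M * C, abs_transferApply_le β hM hφ.measurable hC⟩, fun g U => ?_,
    fun k z hz U => ?_⟩
  · -- gauge invariance
    rw [transferApply_apply, transferApply_apply]
    have hF : Measurable fun V => transferKernel su2Rep β (gaugeTransform g U) V * φ V :=
      (continuous_transferKernel_right β _).measurable.mul hφ.measurable
    rw [← integral_comp_eq_of_measurePreserving (measurePreserving_gaugeTransform_configMeasure g) hF]
    refine integral_congr_ae (ae_of_all _ fun V => ?_)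
    simp only [transferKernel_gaugeTransform, hφ.gaugeInv g V]
  · -- twist invariance
    rw [transferApply_apply, transferApply_apply]
    have hF : Measurable fun V => transferKernel su2Rep β (twist k z U) V * φ V :=
      (continuous_transferKernel_right β _).measurable.mul hφ.measurable
    rw [← integral_comp_eq_of_measurePreserving (measurePreserving_twist k z) hF]
    refine integral_congr_ae (ae_of_all _ fun V => ?_)
    simp only [transferKernel_twist su2Rep β k hz, hφ.zeroFlux k z hz V]

/-! ### §4. The vacuum proxies `Φ_m = K_β^m 1` -/

/-- **`Φ_m = K_β^m 1` is a physical zero-flux test function.** [folklore] -/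
theorem isPhys_slabGround (β : ℝ) (m : ℕ) : IsPhys (slabGround (L := L) β m) := by
  induction m with
  | zero => rw [slabGround_zero]; exact isPhys_const 1
  | succ m ih => rw [slabGround_succ]; exact isPhys_transferApply β ih

/-- **`Φ_m` is uniformly positive**: `Φ_m ≥ c_m > 0` pointwise (`c_{m+1} = (inf K_β) c_m`). [folklore] -/
theorem exists_pos_le_slabGround (β : ℝ) (m : ℕ) : ∃ c : ℝ, 0 < c ∧ ∀ U, c ≤ slabGround (L := L) β m U := by
  obtain ⟨κ, hκ, hκle⟩ := exists_pos_le_transferKernel su2Rep continuous_su2Rep β (L := L)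
  induction m with
  | zero => exact ⟨1, one_pos, fun U => by simp⟩
  | succ m ih =>
    obtain ⟨c, hc, hcle⟩ := ih
    obtain ⟨C, hC⟩ := (isPhys_slabGround (L := L) β m).bounded
    refine ⟨κ * c, mul_pos hκ hc, fun U => ?_⟩
    rw [slabGround_succ]
    calc κ * c ≤ transferApply β (fun _ => c) U := const_mul_le_transferApply_const β hκle hc.le U
      _ ≤ transferApply β (slabGround β m) U :=
          transferApply_mono β measurable_const (C := |c|) (fun _ => le_rfl) (isPhys_slabGround β m).measurable hC hcle U

/-- `Φ_m > 0` pointwise. [folklore] -/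
theorem slabGround_pos (β : ℝ) (m : ℕ) (U : GaugeConfig 3 L SU2) : 0 < slabGround β m U := by
  obtain ⟨c, hc, hle⟩ := exists_pos_le_slabGround (L := L) β m
  exact hc.trans_le (hle U)

/-- **`‖Φ_m‖² > 0`** (every real `β`). [folklore] -/
theorem l2_slabGround_pos (β : ℝ) (m : ℕ) : 0 < l2 (slabGround (L := L) β m) (slabGround β m) := by
  obtain ⟨c, hc, hle⟩ := exists_pos_le_slabGround (L := L) β m
  have hΦ := isPhys_slabGround (L := L) β m
  have h : ∫ _U, c * c ∂configMeasure SU2 L ≤ l2 (slabGround (L := L) β m) (slabGround β m) :=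
    integral_mono (integrable_const _) (hΦ.integrable_mul hΦ) fun U =>
      mul_le_mul (hle U) (hle U) hc.le ((hc.le).trans (hle U))
  have hcc : ∫ _U, c * c ∂configMeasure SU2 L = c * c := by simp
  rw [hcc] at h
  exact (mul_pos hc hc).trans_le h

end Transfer

end Summit.QuantumFields.YangMills.Theorems.FemtoTransferGap

end
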